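import Literature.MathematicalPhysics.QuantumFieldTheory.BalabanImbrieJaffe1984to88.BIJ88SlotMoments308

/-!
# `BalabanImbrieJaffe1984to88.BIJ88SlotMomentsGauss308` — [BalabanImbrieJaffe1988] CMP **114** (1988), Sect. 5.14 pp. 308–309 [PDF 52–53]:
**the slot moments of the p. 308 family IN THE §5.13 GAUSSIAN MODEL are p25's corner expectations of the derivative observables, and
`Σ_γ ⟨Π_{j∈K}(d/dt)_{γ_j} χ′_{Λ,t} e^{−tṼ}⟩_{1,W} = z_t^{(|K|)}`** — the BRIDGE between the analytic side of §5.14 (this seat: Leibniz over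
assignments under the integral sign, `BIJ88SlotMoments308.sum_asg_integral_eq_iteratedDeriv_zt`) and the combinatorial side (p25:
(5.14.3) for the finite-dimensional Gaussian measures of §5.13, `BIJ88Expansion5143Gauss.expansion5143_gauss`): with the derivative
factors `u τ m := ∂_t^m slotFactor_τ` (p25's abstract `u`), the expectation `⟨Π_{i∈W} fD K i⟩_{1,W}` of p25's derivative observables over the
fields of `W` IS the un-normalized slot moment of `BIJ88SlotMoments308` for the Gaussian law of the fields, hence **the left sides of (5.14.3),
summed over the assignments `γ` of the labels of `K`, give the `|K|`-th `t`-derivative of `z_t`** (`sum_asg_zG_fD_eq_iteratedDeriv`), and so do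
the right sides (`sum_asg_expansion5143_gauss_eq_iteratedDeriv`).

statement-level skeleton of published theorems with citation tags; proofs where landed; nothing here is a claim about the Yang–Mills mass gap

THE PRINT (verbatim, p. 308 [PDF 52] / p. 309 [PDF 53]; images `lit-balaban-r16/renders/cmp114/original-p052-x2.png`,
`lit-balaban-ref-1/renders/cmp114/original-p053-x2.png`): *"Here ⟨·⟩_t is the interacting expectation ⟨·⟩_t = (1/z_t(Λ₁₂^{(k)}))
⟨· χ′_{Λ₁₂^{(k)},t} e^{−tṼ^{(k)}(Λ^{(k)}_{12})}⟩_{1,Λ₁₂^{(k)}} … We express each d/dt as a sum Σ_γ (d/dt)_γ, where (d/dt)_γ acts only on the t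
before a particular term V^{(k)}(Y) in Ṽ^{(k)} or in a particular χ-factor. We cluster expand as before each integral making up the truncated
expectation values"*; *"⟨Π_{j∈H} (d/dt)_{γ_j} χ′_{Λ^{(k)}_{12},t} e^{−tṼ^{(k)}(Λ^{(k)}_{12})}⟩_{1,Λ^{(k)}_{12}} = Σ_{{X_α} filling Λ^{(k)}_{12}} Π_β g₃(H_β, X_β).
(5.14.3)"*.

WHAT IS PROVED (definitions with bodies `fieldLaw`, `uD`; theorems; no `Prop` fact).  Setting of p25's `BIJ88PolymerRep5134Gauss` /
`BIJ88Expansion5143Gauss` (sites `α`, cubes `I`, `blk`, precision `Δ`, linear term `ℱ`, region `W`; observables `fD u cube γ K i`).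
* §1 `fieldLaw blk Δ ℱ W` — the Gaussian law `e^{−½⟨φ,Δφ⟩}e^{⟨ℱ,φ⟩}dφ / normalization` of the fields on the sites of `W` as a `Measure`;
  `integral_fieldLaw`; `isProbabilityMeasure_fieldLaw` (`W`-block of `Δ` positive definite); **`expect_corner_eq_integral`**: p25's
  `expect blk Δ ℱ g W (1_W) = ∫ obs g dfieldLaw`; `measurable_ext`.
* §2 `uD χ p ek B Φ c Ys V t τ m φ := ∂_t^m slotFactor_τ(φ)` (fields `Φ_b`, terms `V_Y` as functions of the full field `φ : α → ℝ`);
  `slotFactor_ext`; `obs_fD_eq` (`Π_{i∈W} fD K i = Π_τ ∂_t^{#{j∈K : γ j = τ}} slotFactor_τ` when every slot's cube lies in `W`).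
* §3 **`zt_fieldLaw_eq_zG`** (`z_t` of `BIJ88SlotMoments308` for the Gaussian law `= ⟨Π_i fD ∅ i⟩_{1,W}`) and **`slotMoment_fieldLaw_eq`**
  (`⟨Π_{j∈K}(d/dt)_{γ_j}⟩_t = ⟨Π_i fD K i⟩_{1,W} / ⟨Π_i fD ∅ i⟩_{1,W}`).
* §4 **`sum_asg_zG_fD_eq_iteratedDeriv`**: `Σ_{γ∈asg s₀ K} ⟨Π_{i∈W} fD_t γ K i⟩_{1,W} = (d/dt)^{|K|} ⟨Π_{i∈W} fD_t · ∅ i⟩_{1,W}` on the branch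
  `0 < t`, `te_k < e^{−1}` (block of `Δ` positive definite, cubes of the slots in `W`, measurable `Φ_b`, `c_b ≠ 0`, measurable `|V_Y| ≤ K_Y`);
  normalized form `sum_asg_zG_fD_div_eq`; **`sum_asg_expansion5143_gauss_eq_iteratedDeriv`**: the same with each left side of (5.14.3)
  replaced by its right side (p25's `expansion5143_gauss` BY NAME; range hypothesis `hΔ`, cube-local `Φ_b`, `V_Y`); and
  **`sum_asg_trunc_eq_iteratedDeriv_log_zG`**: for every `κ(·,γ)` solving p. 310 display 2 per assignment against the normalized corner
  expectations, `Σ_{γ∈asg s₀ K} κ(K,γ) = (d/dt)^{|K|} log z_t` (positivity of `z` on the chosen set of `t` displayed).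
* §5 (v1.1, append-only) POSITIVITY IN THE MODEL: `fieldLaw_real_pos_of_isOpen` (the law charges nonempty open sets), `zG_fD_empty_pos`
  (`z_t > 0` for CONTINUOUS fields `Φ_b` with `Φ_b(0) = 0`, e.g. linear, via gen 8's `integral_restrictedInteraction_pos_of_smallBall`), and
  `sum_asg_trunc_eq_iteratedDeriv_log_zG'` = §4's knit with the positivity hypothesis DISCHARGED.

HONEST SCOPE.  Finite-dimensional real Gaussian model of §5.13 as in p25's files (the constraint structure `δ_{Ax}` of the paper's measure not
modelled); positivity of `z_t` is displayed in §4 and DISCHARGED in §5 for continuous fields vanishing at `0`; (5.14.4) and the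
connected-graph resummation are neither used nor asserted.  0 `sorry`; axioms standard.

CITATION HEADER (lean-in-tree rule).  lit-balaban TYPED SKELETON (HOME `run/shared/lean/pub/lit-balaban/`), Phase 2, seat p36 gen 10
(unit `lit-balaban-p36`); rows **C2.Eq5.14.3-5.14.4** ((5.14.3), member) and **C2.Eq5.14.1-5.14.2** ((5.14.2)) of `HOME/lit-balaban-r16/ROWS-C2-part2.md`
(owner r16; heads untouched; p25's decls used BY NAME, nothing restated).  PDF held: `paper:balaban1988-cmp114-bij-abelian-higgs-effective-action`
(journal page = PDF page + 256).  NOT summit progress.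
-/

open Finset MeasureTheory
open Literature.Probability.LatticeModels (IsSetPartition setPartitions mem_setPartitions)
open Literature.MathematicalPhysics.QuantumFieldTheory.Balaban1983to89.B2Eq228Conditioning (weight source weight_pos source_pos
  integrable_weight_mul_source continuous_weight continuous_source)
open Literature.MathematicalPhysics.QuantumFieldTheory.BalabanImbrieJaffe1984to88.BIJ88TruncatedExpectation5142 (asg)

noncomputable section

namespace Literature.MathematicalPhysics.QuantumFieldTheory.BalabanImbrieJaffe1984to88.BIJ88SlotMomentsGauss308

open BIJ88PolymerRep5134 (corner IsAdmissible)
open BIJ88PolymerRep5134Gauss (ext obs prec src expect zG)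
open BIJ88Expansion5143 (g3 slotsIn)
open BIJ88Expansion5143Gauss (fD)
open BIJ88SlotMoments308 (slotFactor zt slotMoment)
open BIJ88Sect5Statements (CutoffProfile)

variable {α I : Type} [Fintype α] [DecidableEq α] [Fintype I] [DecidableEq I]
  (blk : α → I) (Δ : Matrix α α ℝ) (ℱ : α → ℝ) (W : Finset I)

/-! ## §1 The Gaussian law of the fields of `W` as a probability measure -/

/-- **The law of the fields of `W`**: Lebesgue measure on the fields of the sites of `W` with the density
`e^{−½⟨φ,Δ_{1_W}φ⟩}e^{⟨ℱ,φ⟩}` of p25's `expect … W (1_W)`, normalized by its integral (p. 304: *"The expectation ⟨ ⟩_1 is in the measure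
(1/N)∫dΦ … exp[½⟨Φ,ΔΦ⟩ + ⟨Φ,ℱ⟩]"*). [cite: BalabanImbrieJaffe1988, (5.14.3) p.309] -/
def fieldLaw : Measure ({x : α // blk x ∈ W} → ℝ) :=
  (ENNReal.ofReal (∫ φ, weight (prec blk Δ W (corner ℝ W)) φ * source (src blk ℱ W) φ))⁻¹ •
    volume.withDensity fun φ => ENNReal.ofReal (weight (prec blk Δ W (corner ℝ W)) φ * source (src blk ℱ W) φ)

/-- the density is measurable. [cite: BalabanImbrieJaffe1988, (5.14.3) p.309] -/
theorem measurable_density : Measurable fun φ : {x : α // blk x ∈ W} → ℝ =>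
    weight (prec blk Δ W (corner ℝ W)) φ * source (src blk ℱ W) φ :=
  ((continuous_weight _).mul (continuous_source _)).measurable

/-- **Integration against the law** = normalized integration against the density (every integrand; both sides share the junk value).
[cite: BalabanImbrieJaffe1988, (5.14.3) p.309] -/
theorem integral_fieldLaw (g : ({x : α // blk x ∈ W} → ℝ) → ℝ) :
    ∫ φ, g φ ∂(fieldLaw blk Δ ℱ W) =
      (∫ φ, g φ * (weight (prec blk Δ W (corner ℝ W)) φ * source (src blk ℱ W) φ)) /
        ∫ φ, weight (prec blk Δ W (corner ℝ W)) φ * source (src blk ℱ W) φ := by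
  have hm := (measurable_density blk Δ ℱ W).ennreal_ofReal
  have hpos : ∀ φ : {x : α // blk x ∈ W} → ℝ, 0 ≤ weight (prec blk Δ W (corner ℝ W)) φ * source (src blk ℱ W) φ := fun φ =>
    (mul_pos (weight_pos _ φ) (source_pos _ φ)).le
  rw [fieldLaw, integral_smul_measure, integral_withDensity_eq_integral_toReal_smul hm
    (Filter.Eventually.of_forall fun _ => ENNReal.ofReal_lt_top)]
  rw [ENNReal.toReal_inv, ENNReal.toReal_ofReal (integral_nonneg hpos), smul_eq_mul, div_eq_inv_mul]
  congr 1
  refine integral_congr_ae (Filter.Eventually.of_forall fun φ => ?_)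
  show (ENNReal.ofReal _).toReal • g φ = g φ * _
  rw [ENNReal.toReal_ofReal (hpos φ), smul_eq_mul, mul_comm]

open Matrix in
/-- The partition function `∫ e^{−½⟨φ,Δφ⟩}e^{⟨ℱ,φ⟩}dφ` over the fields of `W` is positive (`W`-block positive definite).
[cite: BalabanImbrieJaffe1988, (5.14.3) p.309] -/
theorem integral_density_pos (hPD : (prec blk Δ W (corner ℝ W)).PosDef) :
    0 < ∫ φ, weight (prec blk Δ W (corner ℝ W)) φ * source (src blk ℱ W) φ := by
  have h : ∀ φ : {x : α // blk x ∈ W} → ℝ, weight (prec blk Δ W (corner ℝ W)) φ * source (src blk ℱ W) φ =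
      Real.exp (-(1/2 : ℝ) * (φ ⬝ᵥ prec blk Δ W (corner ℝ W) *ᵥ φ) + ∑ x, src blk ℱ W x * φ x) := fun φ => by
    rw [weight, source, Real.exp_add]
  have hint := integrable_weight_mul_source (prec blk Δ W (corner ℝ W)) (src blk ℱ W) hPD
  simp_rw [h] at hint ⊢
  exact integral_exp_pos hint

/-- The law is a probability measure (`W`-block of the precision positive definite). [cite: BalabanImbrieJaffe1988, (5.14.3) p.309] -/
theorem isProbabilityMeasure_fieldLaw (hPD : (prec blk Δ W (corner ℝ W)).PosDef) :
    IsProbabilityMeasure (fieldLaw blk Δ ℱ W) := by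
  constructor
  have hZ := integral_density_pos blk Δ ℱ W hPD
  have hint := integrable_weight_mul_source (prec blk Δ W (corner ℝ W)) (src blk ℱ W) hPD
  rw [fieldLaw, Measure.smul_apply, withDensity_apply _ MeasurableSet.univ, Measure.restrict_univ,
    ← ofReal_integral_eq_lintegral_ofReal hint
      (Filter.Eventually.of_forall fun φ => (mul_pos (weight_pos _ φ) (source_pos _ φ)).le),
    smul_eq_mul, ENNReal.inv_mul_cancel (ENNReal.ofReal_pos.2 hZ).ne' ENNReal.ofReal_ne_top]

/-- **p25's corner expectation over the fields of `W` is the integral against the law**: `expect blk Δ ℱ g W (1_W) = ∫ Π_{i∈W} g i dfieldLaw`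
(p. 306: *"⟨·⟩_{s_Γ,X} is defined by integrating over the fields in X only"*, at `X = Γ = W`). [cite: BalabanImbrieJaffe1988, (5.14.3) p.309] -/
theorem expect_corner_eq_integral (g : I → (α → ℝ) → ℝ) :
    expect blk Δ ℱ g W (corner ℝ W) = ∫ φ, obs blk g W φ ∂(fieldLaw blk Δ ℱ W) := by
  rw [integral_fieldLaw]; rfl

omit [Fintype α] [DecidableEq α] [Fintype I] in
/-- Extension by zero of a field on the sites of `W` is measurable. [cite: BalabanImbrieJaffe1988, (5.14.3) p.309] -/
theorem measurable_ext : Measurable (ext blk W : ({x : α // blk x ∈ W} → ℝ) → α → ℝ) := by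
  refine measurable_pi_lambda (ext blk W) fun x => ?_
  by_cases h : blk x ∈ W
  · have hx : (fun ω : {x : α // blk x ∈ W} → ℝ => ext blk W ω x) = fun ω => ω ⟨x, h⟩ := by
      funext ω; simp [BIJ88PolymerRep5134Gauss.ext, h]
    rw [hx]; exact measurable_pi_apply _
  · simp only [BIJ88PolymerRep5134Gauss.ext, h]
    exact measurable_const

/-! ## §2 The derivative factors `u τ m = ∂_t^m slotFactor_τ` and p25's derivative observables -/

variable (χ : CutoffProfile) {ι υ : Type*} [DecidableEq ι] [DecidableEq υ]
variable (p ek : ℝ) (B : Finset ι) (Φ : ι → (α → ℝ) → ℝ) (c : ι → ℝ) (Ys : Finset υ) (V : υ → (α → ℝ) → ℝ)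

/-- **The derivative factors** `u τ m φ := ∂_t^m slotFactor_τ(φ)` of the p. 308 family at the field `φ` — the data `u` of p25's
`BIJ88Expansion5143Gauss.fD` (*"u τ m = the m-th t-derivative of the term τ as a function of the field"*): χ-slots `∂_t^m χ(c_b p(te_k), Φ_b(φ))`,
term slots `(−V_Y(φ))^m e^{−tV_Y(φ)}`. [cite: BalabanImbrieJaffe1988, (5.14.3) p.309] -/
def uD (t : ℝ) (τ : ↥B ⊕ ↥Ys) (m : ℕ) (φ : α → ℝ) : ℝ := iteratedDeriv m (slotFactor χ p ek B Φ c Ys V φ τ) t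

omit [Fintype α] [DecidableEq α] [Fintype I] [DecidableEq ι] [DecidableEq υ] in
/-- The slot factors of the fields seen through the extension map are the slot factors at the extended field.
[cite: BalabanImbrieJaffe1988, (5.14.3) p.309] -/
theorem slotFactor_ext (ω : {x : α // blk x ∈ W} → ℝ) :
    slotFactor χ p ek B (fun b ω => Φ b (ext blk W ω)) c Ys (fun Y ω => V Y (ext blk W ω)) ω =
      slotFactor χ p ek B Φ c Ys V (ext blk W ω) := by
  funext τ; rcases τ with b | Y <;> rfl

variable (cube : ↥B ⊕ ↥Ys → I)

omit [Fintype α] [DecidableEq α] [Fintype I] in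
/-- **p25's observable `Π_{i∈W} fD K i` is the differentiated product of the slot factors** `Π_τ ∂_t^{#{j∈K : γ j = τ}} slotFactor_τ`
(every slot's cube lies in `W`; regrouping the slots by cube). [cite: BalabanImbrieJaffe1988, (5.14.3) p.309] -/
theorem obs_fD_eq (hcube : ∀ τ, cube τ ∈ W) (t : ℝ) {L : Type*} (K : Finset L) (γ : L → ↥B ⊕ ↥Ys)
    (ω : {x : α // blk x ∈ W} → ℝ) :
    obs blk (fD (uD χ p ek B Φ c Ys V t) cube γ K) W ω =
      ∏ τ, iteratedDeriv ((K.filter fun j => γ j = τ).card) (slotFactor χ p ek B Φ c Ys V (ext blk W ω) τ) t := by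
  simp only [obs, fD, uD]
  exact prod_fiberwise_of_maps_to (fun τ _ => hcube τ) _

omit [Fintype α] [DecidableEq α] [Fintype I] in
/-- No slot: `Π_{i∈W} fD ∅ i = Π_τ slotFactor_τ(t)`, the undifferentiated integrand. [cite: BalabanImbrieJaffe1988, (5.14.3) p.309] -/
theorem obs_fD_empty (hcube : ∀ τ, cube τ ∈ W) (t : ℝ) {L : Type*} (γ : L → ↥B ⊕ ↥Ys)
    (ω : {x : α // blk x ∈ W} → ℝ) :
    obs blk (fD (uD χ p ek B Φ c Ys V t) cube γ ∅) W ω = ∏ τ, slotFactor χ p ek B Φ c Ys V (ext blk W ω) τ t := by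
  rw [obs_fD_eq blk W χ p ek B Φ c Ys V cube hcube]
  simp

/-! ## §3 `z_t` and the slot moments in the model are corner expectations of the derivative observables -/

/-- **`z_t = ⟨Π_{i∈W} fD ∅ i⟩_{1,W}`**: the `z_t` of `BIJ88SlotMoments308` for the Gaussian law of the fields of `W` (fields and terms read
through the extension map) is p25's corner expectation of the undifferentiated observables. [cite: BalabanImbrieJaffe1988, (5.14.3) p.309] -/
theorem zt_fieldLaw_eq_zG (hcube : ∀ τ, cube τ ∈ W) {L : Type*} (γ : L → ↥B ⊕ ↥Ys) (t : ℝ) :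
    zt χ p ek B (fun b ω => Φ b (ext blk W ω)) c Ys (fun Y ω => V Y (ext blk W ω)) (fieldLaw blk Δ ℱ W) t =
      zG blk Δ ℱ (fD (uD χ p ek B Φ c Ys V t) cube γ ∅) W W := by
  rw [zG, expect_corner_eq_integral blk Δ ℱ W (fD (uD χ p ek B Φ c Ys V t) cube γ ∅)]
  simp only [zt]
  refine integral_congr_ae (Filter.Eventually.of_forall fun ω => ?_)
  simp only [obs_fD_empty blk W χ p ek B Φ c Ys V cube hcube, slotFactor_ext]

/-- **`⟨Π_{j∈K}(d/dt)_{γ_j}⟩_t = ⟨Π_{i∈W} fD K i⟩_{1,W} / ⟨Π_{i∈W} fD ∅ i⟩_{1,W}`**: the slot moments of `BIJ88SlotMoments308` in the model are the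
normalized corner expectations of p25's derivative observables (*"⟨·⟩_t = (1/z_t)⟨· χ′ e^{−tṼ}⟩_1"*). [cite: BalabanImbrieJaffe1988, (5.14.3) p.309] -/
theorem slotMoment_fieldLaw_eq (hcube : ∀ τ, cube τ ∈ W) (t : ℝ) {L : Type*} (K : Finset L) (γ : L → ↥B ⊕ ↥Ys) :
    slotMoment χ p ek B (fun b ω => Φ b (ext blk W ω)) c Ys (fun Y ω => V Y (ext blk W ω)) (fieldLaw blk Δ ℱ W) t K γ =
      zG blk Δ ℱ (fD (uD χ p ek B Φ c Ys V t) cube γ K) W W /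
        zG blk Δ ℱ (fD (uD χ p ek B Φ c Ys V t) cube γ ∅) W W := by
  simp only [slotMoment]
  rw [zt_fieldLaw_eq_zG blk Δ ℱ W χ p ek B Φ c Ys V cube hcube γ, zG, zG,
    expect_corner_eq_integral blk Δ ℱ W (fD (uD χ p ek B Φ c Ys V t) cube γ K)]
  congr 1
  refine integral_congr_ae (Filter.Eventually.of_forall fun ω => ?_)
  simp only [obs_fD_eq blk W χ p ek B Φ c Ys V cube hcube, slotFactor_ext]

/-! ## §4 `Σ_γ ⟨Π_{j∈K}(d/dt)_{γ_j} χ′ e^{−tṼ}⟩_{1,W} = z_t^{(|K|)}`: both sides of (5.14.3) summed over the assignments -/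

variable {p ek B Φ c Ys V}

/-- **`Σ_{γ ∈ asg s₀ K} ⟨Π_{i∈W} fD_t γ K i⟩_{1,W} = (d/dt)^{|K|} ⟨Π_{i∈W} fD_t ∅ i⟩_{1,W}`** — the LEFT sides of (5.14.3), summed over the
assignments of the labels of `K`, give the `|K|`-th `t`-derivative of `z_t`, on the branch `0 < t`, `te_k < e^{−1}` (`W`-block of `Δ` positive
definite, cubes of the slots in `W`, measurable `Φ_b`, `c_b ≠ 0`, measurable `|V_Y| ≤ K_Y`): `BIJ88SlotMoments308.sum_asg_integral_eq_iteratedDeriv_zt`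
for the Gaussian law ∘ §3. [cite: BalabanImbrieJaffe1988, (5.14.3) p.309; (5.14.2) p.308] -/
theorem sum_asg_zG_fD_eq_iteratedDeriv (hPD : (prec blk Δ W (corner ℝ W)).PosDef) (hcube : ∀ τ, cube τ ∈ W)
    (hΦ : ∀ b ∈ B, Measurable (Φ b)) (hc : ∀ b ∈ B, c b ≠ 0) (hV : ∀ Y ∈ Ys, Measurable (V Y)) {KY : υ → ℝ}
    (hK : ∀ Y ∈ Ys, ∀ φ, |V Y φ| ≤ KY Y) (hek : 0 < ek) {L : Type*} [Fintype L] [DecidableEq L] (s₀ : ↥B ⊕ ↥Ys)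
    (K : Finset L) (γ₀ : L → ↥B ⊕ ↥Ys) {t : ℝ} (ht : 0 < t) (h1 : t * ek < Real.exp (-1)) :
    ∑ γ ∈ asg s₀ K, zG blk Δ ℱ (fD (uD χ p ek B Φ c Ys V t) cube γ K) W W =
      iteratedDeriv K.card (fun t' => zG blk Δ ℱ (fD (uD χ p ek B Φ c Ys V t') cube γ₀ ∅) W W) t := by
  haveI := isProbabilityMeasure_fieldLaw blk Δ ℱ W hPD
  have hΦ' : ∀ b ∈ B, Measurable fun ω : {x : α // blk x ∈ W} → ℝ => Φ b (ext blk W ω) := fun b hb =>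
    (hΦ b hb).comp (measurable_ext blk W)
  have hV' : ∀ Y ∈ Ys, Measurable fun ω : {x : α // blk x ∈ W} → ℝ => V Y (ext blk W ω) := fun Y hY =>
    (hV Y hY).comp (measurable_ext blk W)
  have h := BIJ88SlotMoments308.sum_asg_integral_eq_iteratedDeriv_zt χ (p := p) (fieldLaw blk Δ ℱ W) hΦ' hc hV'
    (fun Y hY ω => hK Y hY _) hek s₀ K ht h1
  have hz : zt χ p ek B (fun b ω => Φ b (ext blk W ω)) c Ys (fun Y ω => V Y (ext blk W ω)) (fieldLaw blk Δ ℱ W) =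
      fun t' => zG blk Δ ℱ (fD (uD χ p ek B Φ c Ys V t') cube γ₀ ∅) W W :=
    funext fun t' => zt_fieldLaw_eq_zG blk Δ ℱ W χ p ek B Φ c Ys V cube hcube γ₀ t'
  rw [hz] at h
  rw [← h]
  refine sum_congr rfl fun γ _ => ?_
  rw [zG, expect_corner_eq_integral blk Δ ℱ W (fD (uD χ p ek B Φ c Ys V t) cube γ K)]
  refine integral_congr_ae (Filter.Eventually.of_forall fun ω => ?_)
  simp only [obs_fD_eq blk W χ p ek B Φ c Ys V cube hcube, slotFactor_ext]

/-- **Normalized: `Σ_{γ ∈ asg s₀ K} ⟨Π_i fD_t γ K i⟩_{1,W} / ⟨Π_i fD_t ∅ i⟩_{1,W} = z_t^{(|K|)}/z_t`** (the right side written with the same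
corner expectation `z_{t'} = ⟨Π_i fD_{t'} ∅ i⟩_{1,W}`). [cite: BalabanImbrieJaffe1988, (5.14.3) p.309; (5.14.2) p.308] -/
theorem sum_asg_zG_fD_div_eq (hPD : (prec blk Δ W (corner ℝ W)).PosDef) (hcube : ∀ τ, cube τ ∈ W)
    (hΦ : ∀ b ∈ B, Measurable (Φ b)) (hc : ∀ b ∈ B, c b ≠ 0) (hV : ∀ Y ∈ Ys, Measurable (V Y)) {KY : υ → ℝ}
    (hK : ∀ Y ∈ Ys, ∀ φ, |V Y φ| ≤ KY Y) (hek : 0 < ek) {L : Type*} [Fintype L] [DecidableEq L] (s₀ : ↥B ⊕ ↥Ys)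
    (K : Finset L) (γ₀ : L → ↥B ⊕ ↥Ys) {t : ℝ} (ht : 0 < t) (h1 : t * ek < Real.exp (-1)) :
    ∑ γ ∈ asg s₀ K, zG blk Δ ℱ (fD (uD χ p ek B Φ c Ys V t) cube γ K) W W /
        zG blk Δ ℱ (fD (uD χ p ek B Φ c Ys V t) cube γ ∅) W W =
      iteratedDeriv K.card (fun t' => zG blk Δ ℱ (fD (uD χ p ek B Φ c Ys V t') cube γ₀ ∅) W W) t /
        zG blk Δ ℱ (fD (uD χ p ek B Φ c Ys V t) cube γ₀ ∅) W W := by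
  have hden : ∀ γ : L → ↥B ⊕ ↥Ys, zG blk Δ ℱ (fD (uD χ p ek B Φ c Ys V t) cube γ ∅) W W =
      zG blk Δ ℱ (fD (uD χ p ek B Φ c Ys V t) cube γ₀ ∅) W W := fun γ => by
    rw [← zt_fieldLaw_eq_zG blk Δ ℱ W χ p ek B Φ c Ys V cube hcube γ t, zt_fieldLaw_eq_zG blk Δ ℱ W χ p ek B Φ c Ys V cube hcube γ₀ t]
  simp only [hden]
  rw [← sum_div, sum_asg_zG_fD_eq_iteratedDeriv blk Δ ℱ W χ cube hPD hcube hΦ hc hV hK hek s₀ K γ₀ ht h1]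

/-- **Both sides of (5.14.3) summed over the assignments**: with p25's `expansion5143_gauss` (range hypothesis `hΔ`; `Φ_b`, `V_Y` local in the
cube of their slot) the left sides become the cluster expansions `Σ_{{X_β} admissible filling W} Π_β g₃(H_β,X_β)`, and their sum over
`γ ∈ asg s₀ K` is `(d/dt)^{|K|} z_t`. [cite: BalabanImbrieJaffe1988, (5.14.3) p.309; (5.14.2) p.308] -/
theorem sum_asg_expansion5143_gauss_eq_iteratedDeriv (adj : I → I → Prop) [DecidableRel adj]
    (hΔ : ∀ x y, blk x ≠ blk y → ¬ adj (blk x) (blk y) → Δ x y = 0) (hPD : (prec blk Δ W (corner ℝ W)).PosDef)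
    (hcube : ∀ τ, cube τ ∈ W)
    (hΦloc : ∀ b : B, ∀ φ ψ : α → ℝ, (∀ x, blk x = cube (Sum.inl b) → φ x = ψ x) → Φ b φ = Φ b ψ)
    (hVloc : ∀ Y : Ys, ∀ φ ψ : α → ℝ, (∀ x, blk x = cube (Sum.inr Y) → φ x = ψ x) → V Y φ = V Y ψ)
    (hΦ : ∀ b ∈ B, Measurable (Φ b)) (hc : ∀ b ∈ B, c b ≠ 0) (hV : ∀ Y ∈ Ys, Measurable (V Y)) {KY : υ → ℝ}
    (hK : ∀ Y ∈ Ys, ∀ φ, |V Y φ| ≤ KY Y) (hek : 0 < ek) {L : Type*} [Fintype L] [DecidableEq L] (s₀ : ↥B ⊕ ↥Ys)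
    (K : Finset L) (γ₀ : L → ↥B ⊕ ↥Ys) {t : ℝ} (ht : 0 < t) (h1 : t * ek < Real.exp (-1)) :
    ∑ γ ∈ asg s₀ K, ∑ P ∈ (setPartitions W).filter (IsAdmissible adj),
        ∏ X ∈ P, g3 adj (fun H => zG blk Δ ℱ (fD (uD χ p ek B Φ c Ys V t) cube γ H)) (slotsIn (cube ∘ γ) K X) X =
      iteratedDeriv K.card (fun t' => zG blk Δ ℱ (fD (uD χ p ek B Φ c Ys V t') cube γ₀ ∅) W W) t := by
  rw [← sum_asg_zG_fD_eq_iteratedDeriv blk Δ ℱ W χ cube hPD hcube hΦ hc hV hK hek s₀ K γ₀ ht h1]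
  refine sum_congr rfl fun γ _ => ?_
  have hu : ∀ τ m (φ ψ : α → ℝ), (∀ x, blk x = cube τ → φ x = ψ x) →
      uD χ p ek B Φ c Ys V t τ m φ = uD χ p ek B Φ c Ys V t τ m ψ := by
    intro τ m φ ψ hφψ
    rcases τ with b | Y
    · simp only [uD, BIJ88SlotMoments308.slotFactor_inl, hΦloc b φ ψ hφψ]
    · simp only [uD, BIJ88SlotMoments308.slotFactor_inr, hVloc Y φ ψ hφψ]
  exact (BIJ88Expansion5143Gauss.expansion5143_gauss blk Δ ℱ γ adj hΔ hu K W).symm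

/-- **`Σ_{γ ∈ asg s₀ K} ⟨(d/dt)_{γ_{j_1}}; …⟩_t = (d/dt)^{|K|} log z_t` IN THE MODEL**: for `t` in a set of unique differentiability
`s ⊆ (0, e^{−1}/e_k)` on which `z > 0`, and every `κ(·,γ)` solving p. 310 display 2 per assignment `γ` against the normalized corner
expectations `⟨Π_i fD_t γ K i⟩_{1,W}/⟨Π_i fD_t γ ∅ i⟩_{1,W}` (`∅ ≠ K ⊆ H`): `Σ_{γ∈asg s₀ K} κ(K,γ) = (d/dt)^{|K|} log ⟨Π_i fD ∅ i⟩_{1,W}` —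
`BIJ88SlotMoments308.sum_asg_trunc_eq_iteratedDeriv_log_zt` ∘ §3. [cite: BalabanImbrieJaffe1988, (5.14.3) p.309; (5.14.2) p.308; p.310 display 2] -/
theorem sum_asg_trunc_eq_iteratedDeriv_log_zG (hPD : (prec blk Δ W (corner ℝ W)).PosDef) (hcube : ∀ τ, cube τ ∈ W)
    (hΦ : ∀ b ∈ B, Measurable (Φ b)) (hc : ∀ b ∈ B, c b ≠ 0) (hV : ∀ Y ∈ Ys, Measurable (V Y)) {KY : υ → ℝ}
    (hK : ∀ Y ∈ Ys, ∀ φ, |V Y φ| ≤ KY Y) (hek : 0 < ek) {s : Set ℝ} (hs : UniqueDiffOn ℝ s)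
    (hsub : s ⊆ Set.Ioo 0 (Real.exp (-1) / ek)) {L : Type*} [Fintype L] [DecidableEq L] (s₀ : ↥B ⊕ ↥Ys) (γ₀ : L → ↥B ⊕ ↥Ys)
    (hzpos : ∀ x ∈ s, 0 < zG blk Δ ℱ (fD (uD χ p ek B Φ c Ys V x) cube γ₀ ∅) W W) {H : Finset L} {t : ℝ} (ht : t ∈ s)
    {κ : Finset L → (L → ↥B ⊕ ↥Ys) → ℝ}
    (hκ : ∀ γ, ∀ K ⊆ H, K.Nonempty →
      zG blk Δ ℱ (fD (uD χ p ek B Φ c Ys V t) cube γ K) W W / zG blk Δ ℱ (fD (uD χ p ek B Φ c Ys V t) cube γ ∅) W W =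
        ∑ π ∈ setPartitions K, ∏ A ∈ π, κ A γ) :
    ∀ K ⊆ H, K.Nonempty → ∑ γ ∈ asg s₀ K, κ K γ =
      iteratedDeriv K.card (fun x => Real.log (zG blk Δ ℱ (fD (uD χ p ek B Φ c Ys V x) cube γ₀ ∅) W W)) t := by
  haveI := isProbabilityMeasure_fieldLaw blk Δ ℱ W hPD
  have hΦ' : ∀ b ∈ B, Measurable fun ω : {x : α // blk x ∈ W} → ℝ => Φ b (ext blk W ω) := fun b hb =>
    (hΦ b hb).comp (measurable_ext blk W)
  have hV' : ∀ Y ∈ Ys, Measurable fun ω : {x : α // blk x ∈ W} → ℝ => V Y (ext blk W ω) := fun Y hY =>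
    (hV Y hY).comp (measurable_ext blk W)
  have hz : zt χ p ek B (fun b ω => Φ b (ext blk W ω)) c Ys (fun Y ω => V Y (ext blk W ω)) (fieldLaw blk Δ ℱ W) =
      fun t' => zG blk Δ ℱ (fD (uD χ p ek B Φ c Ys V t') cube γ₀ ∅) W W :=
    funext fun t' => zt_fieldLaw_eq_zG blk Δ ℱ W χ p ek B Φ c Ys V cube hcube γ₀ t'
  have h := BIJ88SlotMoments308.sum_asg_trunc_eq_iteratedDeriv_log_zt χ (p := p) (fieldLaw blk Δ ℱ W) hΦ' hc hV'
    (fun Y hY ω => hK Y hY _) hek hs hsub (by rw [hz]; exact hzpos) s₀ (H := H) ht (κ := κ) fun γ K hKH hKne => by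
      rw [slotMoment_fieldLaw_eq blk Δ ℱ W χ p ek B Φ c Ys V cube hcube t K γ,
        ← zt_fieldLaw_eq_zG blk Δ ℱ W χ p ek B Φ c Ys V cube hcube γ t, zt_fieldLaw_eq_zG blk Δ ℱ W χ p ek B Φ c Ys V cube hcube γ₀ t]
      exact hκ γ K hKH hKne
  rwa [hz] at h

/-! ## §5 (v1.1) Positivity in the model: `z_t > 0` for continuous fields vanishing at `φ = 0` (e.g. linear), and the knit with it -/

/-- **The law charges every nonempty open set of fields** (Lebesgue density `> 0` everywhere; `W`-block positive definite).
[cite: BalabanImbrieJaffe1988, (5.14.3) p.309] -/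
theorem fieldLaw_real_pos_of_isOpen (hPD : (prec blk Δ W (corner ℝ W)).PosDef) {U : Set ({x : α // blk x ∈ W} → ℝ)}
    (hU : IsOpen U) (hne : U.Nonempty) : 0 < (fieldLaw blk Δ ℱ W).real U := by
  haveI := isProbabilityMeasure_fieldLaw blk Δ ℱ W hPD
  rw [measureReal_def, ENNReal.toReal_pos_iff]
  refine ⟨?_, measure_lt_top _ _⟩
  have hm := (measurable_density blk Δ ℱ W).ennreal_ofReal
  have hsupp : Function.support (fun φ : {x : α // blk x ∈ W} → ℝ =>
      ENNReal.ofReal (weight (prec blk Δ W (corner ℝ W)) φ * source (src blk ℱ W) φ)) = Set.univ :=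
    Set.eq_univ_iff_forall.2 fun φ => Function.mem_support.2
      (ENNReal.ofReal_pos.2 (mul_pos (weight_pos _ φ) (source_pos _ φ))).ne'
  rw [fieldLaw, Measure.smul_apply, withDensity_apply _ hU.measurableSet, smul_eq_mul]
  refine ENNReal.mul_pos (ENNReal.inv_ne_zero.2 ENNReal.ofReal_ne_top) (ne_of_gt ?_)
  rw [setLIntegral_pos_iff hm, hsupp, Set.univ_inter]
  exact hU.measure_pos volume hne

omit [Fintype α] [DecidableEq α] [Fintype I] in
/-- Extension by zero is continuous. [cite: BalabanImbrieJaffe1988, (5.14.3) p.309] -/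
theorem continuous_ext : Continuous (ext blk W : ({x : α // blk x ∈ W} → ℝ) → α → ℝ) := by
  refine continuous_pi fun x => ?_
  by_cases h : blk x ∈ W
  · have hx : (fun ω : {x : α // blk x ∈ W} → ℝ => ext blk W ω x) = fun ω => ω ⟨x, h⟩ := by
      funext ω; simp [BIJ88PolymerRep5134Gauss.ext, h]
    rw [hx]; exact continuous_apply _
  · simp only [BIJ88PolymerRep5134Gauss.ext, h]
    exact continuous_const

omit [Fintype α] [DecidableEq α] [Fintype I] in
/-- Extension of the zero field is the zero field. [cite: BalabanImbrieJaffe1988, (5.14.3) p.309] -/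
theorem ext_zero : ext blk W (0 : {x : α // blk x ∈ W} → ℝ) = 0 := by
  funext x; simp [BIJ88PolymerRep5134Gauss.ext]

/-- **`z_t > 0` in the model** (`χ(1,·) ≥ 0`, `p ≥ 0`, `W`-block positive definite, CONTINUOUS fields `Φ_b` with `Φ_b(0) = 0` — e.g. the
linear functionals of the print —, `c_b ≥ c₀ > 0`, measurable `|V_Y| ≤ K_Y`, `0 < t`, `te_k ≤ e^{−1}`): the small-field box
`{|Φ_b| < (9/10)c₀, b ∈ Λ}` is an open neighbourhood of the zero field, hence charged by the law, and gen 8's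
`BIJ88ZtPositivity308.integral_restrictedInteraction_pos_of_smallBall` applies. [cite: BalabanImbrieJaffe1988, (5.14.2) p.308] -/
theorem zG_fD_empty_pos (hχ : ∀ x, 0 ≤ χ.χ₁ x) (hp : 0 ≤ p) (hPD : (prec blk Δ W (corner ℝ W)).PosDef)
    (hcube : ∀ τ, cube τ ∈ W) (hΦc : ∀ b ∈ B, Continuous (Φ b)) (hΦ0 : ∀ b ∈ B, Φ b 0 = 0) {c₀ : ℝ} (hc₀ : 0 < c₀)
    (hcb : ∀ b ∈ B, c₀ ≤ c b) (hV : ∀ Y ∈ Ys, Measurable (V Y)) {KY : υ → ℝ} (hK : ∀ Y ∈ Ys, ∀ φ, |V Y φ| ≤ KY Y)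
    (hek : 0 < ek) {L : Type*} (γ : L → ↥B ⊕ ↥Ys) {t : ℝ} (ht : 0 < t) (h1 : t * ek ≤ Real.exp (-1)) :
    0 < zG blk Δ ℱ (fD (uD χ p ek B Φ c Ys V t) cube γ ∅) W W := by
  haveI := isProbabilityMeasure_fieldLaw blk Δ ℱ W hPD
  have hΦ' : ∀ b ∈ B, Measurable fun ω : {x : α // blk x ∈ W} → ℝ => Φ b (ext blk W ω) := fun b hb =>
    ((hΦc b hb).comp (continuous_ext blk W)).measurable
  have hV' : ∀ Y ∈ Ys, Measurable fun ω : {x : α // blk x ∈ W} → ℝ => V Y (ext blk W ω) := fun Y hY =>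
    (hV Y hY).comp (measurable_ext blk W)
  rw [← zt_fieldLaw_eq_zG blk Δ ℱ W χ p ek B Φ c Ys V cube hcube γ t, BIJ88SlotMoments308.zt_eq]
  refine BIJ88ZtPositivity308.integral_restrictedInteraction_pos_of_smallBall χ hχ hp (fieldLaw blk Δ ℱ W) B hΦ' hc₀ hcb
    (BIJ88SlotMoments308.measurable_sumV hV') (BIJ88SlotMoments308.abs_sumV_le fun Y hY ω => hK Y hY _) hek ?_ ht h1
  have hopen : IsOpen {ω : {x : α // blk x ∈ W} → ℝ | ∀ b ∈ B, |Φ b (ext blk W ω)| < 9 / 10 * c₀} := by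
    have hset : {ω : {x : α // blk x ∈ W} → ℝ | ∀ b ∈ B, |Φ b (ext blk W ω)| < 9 / 10 * c₀} =
        ⋂ b ∈ B, {ω | |Φ b (ext blk W ω)| < 9 / 10 * c₀} := by
      ext ω; simp
    rw [hset]
    exact isOpen_biInter_finset fun b hb =>
      isOpen_lt (((hΦc b hb).comp (continuous_ext blk W)).abs) continuous_const
  refine fieldLaw_real_pos_of_isOpen blk Δ ℱ W hPD hopen ⟨0, fun b hb => ?_⟩
  rw [ext_zero, hΦ0 b hb, abs_zero]
  linarith

/-- **`Σ_{γ ∈ asg s₀ K} ⟨(d/dt)_{γ_{j_1}}; …⟩_t = (d/dt)^{|K|} log z_t` IN THE MODEL, positivity DISCHARGED**: as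
`sum_asg_trunc_eq_iteratedDeriv_log_zG`, for `t` in any set of unique differentiability `s ⊆ (0, e^{−1}/e_k)`, with the structural
hypotheses of `zG_fD_empty_pos` (continuous `Φ_b` vanishing at `0`, `χ ≥ 0`, `p ≥ 0`, `c_b ≥ c₀ > 0`) in place of `z > 0` on `s`.
[cite: BalabanImbrieJaffe1988, (5.14.3) p.309; (5.14.2) p.308; p.310 display 2] -/
theorem sum_asg_trunc_eq_iteratedDeriv_log_zG' (hχ : ∀ x, 0 ≤ χ.χ₁ x) (hp : 0 ≤ p)
    (hPD : (prec blk Δ W (corner ℝ W)).PosDef) (hcube : ∀ τ, cube τ ∈ W) (hΦc : ∀ b ∈ B, Continuous (Φ b))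
    (hΦ0 : ∀ b ∈ B, Φ b 0 = 0) {c₀ : ℝ} (hc₀ : 0 < c₀) (hcb : ∀ b ∈ B, c₀ ≤ c b) (hV : ∀ Y ∈ Ys, Measurable (V Y))
    {KY : υ → ℝ} (hK : ∀ Y ∈ Ys, ∀ φ, |V Y φ| ≤ KY Y) (hek : 0 < ek) {s : Set ℝ} (hs : UniqueDiffOn ℝ s)
    (hsub : s ⊆ Set.Ioo 0 (Real.exp (-1) / ek)) {L : Type*} [Fintype L] [DecidableEq L] (s₀ : ↥B ⊕ ↥Ys) (γ₀ : L → ↥B ⊕ ↥Ys)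
    {H : Finset L} {t : ℝ} (ht : t ∈ s) {κ : Finset L → (L → ↥B ⊕ ↥Ys) → ℝ}
    (hκ : ∀ γ, ∀ K ⊆ H, K.Nonempty →
      zG blk Δ ℱ (fD (uD χ p ek B Φ c Ys V t) cube γ K) W W / zG blk Δ ℱ (fD (uD χ p ek B Φ c Ys V t) cube γ ∅) W W =
        ∑ π ∈ setPartitions K, ∏ A ∈ π, κ A γ) :
    ∀ K ⊆ H, K.Nonempty → ∑ γ ∈ asg s₀ K, κ K γ =
      iteratedDeriv K.card (fun x => Real.log (zG blk Δ ℱ (fD (uD χ p ek B Φ c Ys V x) cube γ₀ ∅) W W)) t :=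
  sum_asg_trunc_eq_iteratedDeriv_log_zG blk Δ ℱ W χ cube hPD hcube (fun b hb => (hΦc b hb).measurable)
    (fun b hb => (hc₀.trans_le (hcb b hb)).ne') hV hK hek hs hsub s₀ γ₀
    (fun x hx => zG_fD_empty_pos blk Δ ℱ W χ cube hχ hp hPD hcube hΦc hΦ0 hc₀ hcb hV hK hek γ₀ (hsub hx).1
      (by rw [← le_div_iff₀ hek]; exact (hsub hx).2.le)) ht hκ

end Literature.MathematicalPhysics.QuantumFieldTheory.BalabanImbrieJaffe1984to88.BIJ88SlotMomentsGauss308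

end
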